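import Literature.AlgebraicGeometry.AbelianSchemes.CoverKerBaseChangeAlongBaseIso   -- ★ p849526 (LA4-p03): `kernelClause_baseChangeHom` (any base change `g`); re-exports ★ `SerreTwistBaseChange` (`DualPair.baseChangeHom_similitude_base`)
import Literature.AlgebraicGeometry.AbelianSchemes.TupleIsoViaPointExactIso       -- ★ p848009∕p849555 (LA4-p01): `map_restrictPt_section_eq_of_baseChange_σ_comp` (level sections ⇒ level points)
import Literature.AlgebraicGeometry.AbelianSchemes.SectionBaseChangeAlongHom       -- ★ `sectionBaseChange_comp_baseChangeHom` (pulled-back sections are natural)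
import HarnessLib

/-!
# The GLOBAL Serre-cover rows between two families over `Y`, READ AT ANY FIELD POINT `ℓ : Spec Ω → Y` (the «by base change» half of LEG-E(γ′))

Topic `AlgebraicGeometry/AbelianSchemes`; namespace `Literature.AlgebraicGeometry.AbelianSchemes.AbelianSchemeOver`.  THEOREMS ONLY (no definition,
no named fact, no instance, no notation, no `sorry`); universe-polymorphic.  Cell `hodgecm-mathlib` (D-0151), P6 «MOD programme» (crux hLiu418 =
stmt-HodgeConjecture-24832, `--supports`, count-neutral), line «L4», closer `Lines/F0_P6a_StubESHEET.lean` (WRITTEN ED. 1, socket `stub_SHEET`), ROAD OF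
RECORD v3 = (γ′) «Serre tensor OVER `X`, classified» (LA4-plan (g2) 2026-09-02 08:48:23Z): the twisted family `(B_X := P ⊗_{𝒪_F} 𝔞⁻¹, λ_B, η_B)` lives over
`X = (M_K) ⊗_F Fᵢ` with the cover `c₀ := ψ_P : P → B_X` and its rows (t1)(t1′)(t2)(t3)(t4)(t5) OVER `X` (★ p850393 `serreCover_rows_of_presentation`, ★ p850615
`exists_serreTwist_moduliTuple_of_isCMField_rowA`); the socket `OrganSHEETComplex` asks for these rows PER COMPLEX SHEET POINT `z`, in the body currency
`coverKerBody ℂ …` of the leaf `Lines/F0_P6a_CoverEOfComplex.lean` ED. 1, via the glue `coverKerBody_of_rows_comp_iso` (LA7-p01 (g3) frame v6b) ∕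
`coverKerBody_of_cover_onto_iso` (leaf §3) whose `hcover` INPUT is the seven-clause shape between `P ×_X ℓ` and `B_X ×_X ℓ` over `Spec Ω`.  THIS FILE IS THAT
BASE CHANGE, once: the rows over `Y` for a cover `c : 𝒜 → ℬ` of families with ring actions, dual pairs, polarisations and level structures give the rows over
`Spec Ω` for `c ×_Y ℓ : 𝒜 ×_Y ℓ → ℬ ×_Y ℓ` with the base-changed readers (`baseChangeHom (ρ.i a) ℓ`, `D.baseChange ℓ`, `(pol.baseChange ℓ).lam`,
`restrictPt ℓ (lvl.section_ a)`), for EVERY `ℓ` (LA4-p01 (g3) default organ 2026-09-02, offered on the L4 bus; no other hand).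

THE MATHEMATICS ([MumfordFogartyKirwan1994] Ch. 6 §1 Cor. 6.8, Ch. 7 §2 Def. 7.2–7.3: homomorphisms, dual homomorphisms, polarisations and level sections
base-change; [GortzWedhorn2020] (4.7), (4.15), Def. 4.45: `T′`-points of `A ×_Y S′` transpose to points of `A`; [Shimura1998] §13.1 Thm. 1 ∕ §18.6: the Serre
`𝔞`-transform commutes with base change).  (t1)(t2)(t4) by functoriality of `Over.pullback ℓ`; (t1′) ★ `kernelClause_baseChangeHom` (transposition along
`Over.map ℓ ⊣ Over.pullback ℓ`); (t3) ★ `DualPair.baseChangeHom_similitude_base`; (t5) ★ `sectionBaseChange_comp_baseChangeHom` (the pulled-back basis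
sections correspond under `c ×_Y ℓ`) + ★ `map_restrictPt_section_eq_of_baseChange_σ_comp` (sections ⇒ `Ω`-points).

* **`coverKer_rows_readAt`** — THE HEAD (seven clauses, kernel clause (t1′) included);
* `cover_rows_readAt` — the same without the kernel clause (six clauses, the `CoverE`∕`coverBody` shape).
HC_CM is proved only modulo the 2 remaining named inputs (hLiu418 24832, h413 24833) until rung 0 closes; nothing here is about HC.

## References
* [MumfordFogartyKirwan1994] D. Mumford, J. Fogarty, F. Kirwan, *Geometric Invariant Theory*, 3rd ed. (1994), Ch. 6 §1 Cor. 6.8 (p. 118); Ch. 7 §2 Def. 7.2 (p. 129), Def. 7.3 (p. 130).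
* [GortzWedhorn2020] U. Görtz, T. Wedhorn, *Algebraic Geometry I*, 2nd ed. (2020), Section (4.7) (pp. 107–108), (4.15) (p. 116), Definition 4.45 (p. 117).
* [Shimura1998] G. Shimura, *Abelian Varieties with Complex Multiplication and Modular Functions* (1998), §13.1 Theorem 1 (pp. 97–99), §18.6 (pp. 124–127).
-/

set_option autoImplicit false

noncomputable section

-- Mathlib's `Over`/pull-back API is stated across semireducible wrappers (as in the ★ `AbelianSchemes/*` files).
set_option backward.isDefEq.respectTransparency false

universe u

open CategoryTheory CategoryTheory.Limits AlgebraicGeometry MonoidalCategory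
open scoped MonObj Obj

namespace Literature.AlgebraicGeometry.AbelianSchemes

namespace AbelianSchemeOver

open Literature.AlgebraicGeometry.Motives (AlgPoints specOver)

section RowsAtPoint

variable {Y : Scheme.{u}} {𝒜 ℬ : AbelianSchemeOver Y} {O : Type*} [CommRing O]
  (ρ𝒜 : RingAction O 𝒜) (ρℬ : RingAction O ℬ) (D𝒜 : 𝒜.DualPair) (Dℬ : ℬ.DualPair)
  (pol𝒜 : 𝒜.Polarization D𝒜) (polℬ : ℬ.Polarization Dℬ) {g n : ℕ} (lvl𝒜 : 𝒜.LevelStructure g n) (lvlℬ : ℬ.LevelStructure g n)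
  (𝔞 𝔟 : O → Prop) (ν : O) (N : ℕ) (c : 𝒜.X ⟶ ℬ.X) [IsMonHom c]
  {Ω : Type u} [Field Ω] (ℓ : Spec (.of Ω) ⟶ Y)

/-- **THE GLOBAL SERRE-COVER ROWS, READ AT A FIELD POINT** (kernel clause included).  Let `c : 𝒜 → ℬ` be a homomorphism of abelian schemes over `Y` carrying
ring actions `ρ𝒜`, `ρℬ`, dual pairs, polarisations and level-`n` structures, with the GLOBAL rows (t1) `∀ a ∈ 𝔞, ∃ d, c ≫ d = ρ𝒜(a) ∧ d ≫ c = ρℬ(a)`, (t1′)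
the kernel clause on all `T`-points over `Y`, (t2) `∀ b ∈ 𝔟, ∃ f, c ≫ ρℬ(b) = f ≫ ρℬ(ν)`, (t3) `c ≫ λ_ℬ ≫ c^∨ = λ_𝒜 ≫ [N]`, (t4) `ρ𝒜(a) ≫ c = c ≫ ρℬ(a)`, (t5) the
basis sections correspond `σ_ℬ,i = σ_𝒜,i ≫ c` (the shape of ★ p850393∕p850615 for `c := serreTranslate`, `ρℬ := serreAction`).  THEN for EVERY field point
`ℓ : Spec Ω → Y` the base change `c ×_Y ℓ : 𝒜 ×_Y ℓ → ℬ ×_Y ℓ` satisfies the seven POINT rows with the base-changed readers — exactly the `hcover` input of the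
glue `coverKerBody_of_rows_comp_iso` ∕ `coverKerBody_of_cover_onto_iso` at `B := ℬ ×_Y ℓ`. (t1)(t2)(t4) functoriality of `Over.pullback ℓ`, (t1′) ★
`kernelClause_baseChangeHom`, (t3) ★ `DualPair.baseChangeHom_similitude_base`, (t5) ★ `sectionBaseChange_comp_baseChangeHom` + ★ `map_restrictPt_section_eq_of_baseChange_σ_comp`.
[cite: MumfordFogartyKirwan1994, Ch. 6 §1 Corollary 6.8 (p. 118) and Ch. 7 §2 Definition 7.2 (p. 129), Definition 7.3 (p. 130)] [cite: GortzWedhorn2020, Section (4.7) (pp. 107–108) and (4.15) (p. 116)]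
[cite: Shimura1998, §13.1 Theorem 1 (pp. 97–99); §18.6 (pp. 124–127)] -/
theorem coverKer_rows_readAt
    (t1 : ∀ a, 𝔞 a → ∃ d : ℬ.X ⟶ 𝒜.X, c ≫ d = ρ𝒜.i a ∧ d ≫ c = ρℬ.i a)
    (t1' : ∀ ⦃T : Over Y⦄ (t : T ⟶ 𝒜.X), t ≫ c = 1 ↔ ∀ a, 𝔞 a → t ≫ ρ𝒜.i a = 1)
    (t2 : ∀ b, 𝔟 b → ∃ f : 𝒜.X ⟶ ℬ.X, c ≫ ρℬ.i b = f ≫ ρℬ.i ν)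
    (t3 : c ≫ polℬ.lam ≫ DualPair.dualIsogenyOver c D𝒜 Dℬ = pol𝒜.lam ≫ D𝒜.hat.mulN N)
    (t4 : ∀ a, ρ𝒜.i a ≫ c = c ≫ ρℬ.i a)
    (t5 : ∀ i, lvlℬ.σ i = lvl𝒜.σ i ≫ c) :
    ∃ (cℓ : (𝒜.baseChange ℓ).X ⟶ (ℬ.baseChange ℓ).X) (_ : IsMonHom cℓ),
        (∀ a, 𝔞 a → ∃ d : (ℬ.baseChange ℓ).X ⟶ (𝒜.baseChange ℓ).X,
          cℓ ≫ d = baseChangeHom (ρ𝒜.i a) ℓ ∧ d ≫ cℓ = baseChangeHom (ρℬ.i a) ℓ) ∧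
        (∀ ⦃T : Literature.AlgebraicGeometry.Motives.SchemeOver Ω⦄ (t : T ⟶ (𝒜.baseChange ℓ).X),
          t ≫ cℓ = 1 ↔ ∀ a, 𝔞 a → t ≫ baseChangeHom (ρ𝒜.i a) ℓ = 1) ∧
        (∀ b, 𝔟 b → ∃ f : (𝒜.baseChange ℓ).X ⟶ (ℬ.baseChange ℓ).X,
          cℓ ≫ baseChangeHom (ρℬ.i b) ℓ = f ≫ baseChangeHom (ρℬ.i ν) ℓ) ∧
        cℓ ≫ (polℬ.baseChange ℓ).lam ≫ DualPair.dualIsogenyOver cℓ (D𝒜.baseChange ℓ) (Dℬ.baseChange ℓ) =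
          (pol𝒜.baseChange ℓ).lam ≫ (D𝒜.baseChange ℓ).hat.mulN N ∧
        (∀ a, baseChangeHom (ρ𝒜.i a) ℓ ≫ cℓ = cℓ ≫ baseChangeHom (ρℬ.i a) ℓ) ∧
        (∀ a : Fin g ⊕ Fin g → ZMod n,
          (AlgPoints.map cℓ (𝒜.restrictPt ℓ (lvl𝒜.section_ a)) : (ℬ.baseChange ℓ).toAffine.toAbelianVariety.Points Ω) =
            ℬ.restrictPt ℓ (lvlℬ.section_ a)) := by
  haveI := isMonHom_baseChangeHom c ℓ
  refine ⟨baseChangeHom c ℓ, isMonHom_baseChangeHom c ℓ, fun a ha => ?_, kernelClause_baseChangeHom ℓ (fun a => ρ𝒜.i a) c 𝔞 t1',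
    fun b hb => ?_, DualPair.baseChangeHom_similitude_base ℓ c D𝒜 Dℬ pol𝒜.lam polℬ.lam N t3, fun a => ?_, fun a => ?_⟩
  · -- (t1): the Serre presentation base-changes by functoriality
    obtain ⟨d, hcd, hdc⟩ := t1 a ha
    refine ⟨baseChangeHom d ℓ, ?_, ?_⟩
    · change (Over.pullback ℓ).map c ≫ (Over.pullback ℓ).map d = (Over.pullback ℓ).map (ρ𝒜.i a)
      rw [← Functor.map_comp, hcd]
    · change (Over.pullback ℓ).map d ≫ (Over.pullback ℓ).map c = (Over.pullback ℓ).map (ρℬ.i a)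
      rw [← Functor.map_comp, hdc]
  · -- (t2): the upper bound base-changes by functoriality
    obtain ⟨f, hf⟩ := t2 b hb
    refine ⟨baseChangeHom f ℓ, ?_⟩
    change (Over.pullback ℓ).map c ≫ (Over.pullback ℓ).map (ρℬ.i b) = (Over.pullback ℓ).map f ≫ (Over.pullback ℓ).map (ρℬ.i ν)
    rw [← Functor.map_comp, ← Functor.map_comp, hf]
  · -- (t4): equivariance base-changes by functoriality
    change (Over.pullback ℓ).map (ρ𝒜.i a) ≫ (Over.pullback ℓ).map c = (Over.pullback ℓ).map c ≫ (Over.pullback ℓ).map (ρℬ.i a)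
    rw [← Functor.map_comp, ← Functor.map_comp, t4 a]
  · -- (t5): the pulled-back basis sections correspond, hence so do the level points
    refine map_restrictPt_section_eq_of_baseChange_σ_comp ℓ lvl𝒜 lvlℬ (baseChangeHom c ℓ) (fun i => ?_) a
    rw [LevelStructure.baseChange_σ, LevelStructure.baseChange_σ, sectionBaseChange_comp_baseChangeHom, ← t5 i]

/-- **The same WITHOUT the kernel clause** (six clauses, the `CoverE`∕`coverBody` shape). [cite: MumfordFogartyKirwan1994, Ch. 6 §1 Corollary 6.8 (p. 118) and Ch. 7 §2 Definition 7.2 (p. 129)]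
[cite: GortzWedhorn2020, Section (4.7) (pp. 107–108)] [cite: Shimura1998, §13.1 Theorem 1 (pp. 97–99); §18.6 (pp. 124–127)] -/
theorem cover_rows_readAt
    (t1 : ∀ a, 𝔞 a → ∃ d : ℬ.X ⟶ 𝒜.X, c ≫ d = ρ𝒜.i a ∧ d ≫ c = ρℬ.i a)
    (t2 : ∀ b, 𝔟 b → ∃ f : 𝒜.X ⟶ ℬ.X, c ≫ ρℬ.i b = f ≫ ρℬ.i ν)
    (t3 : c ≫ polℬ.lam ≫ DualPair.dualIsogenyOver c D𝒜 Dℬ = pol𝒜.lam ≫ D𝒜.hat.mulN N)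
    (t4 : ∀ a, ρ𝒜.i a ≫ c = c ≫ ρℬ.i a)
    (t5 : ∀ i, lvlℬ.σ i = lvl𝒜.σ i ≫ c) :
    ∃ (cℓ : (𝒜.baseChange ℓ).X ⟶ (ℬ.baseChange ℓ).X) (_ : IsMonHom cℓ),
        (∀ a, 𝔞 a → ∃ d : (ℬ.baseChange ℓ).X ⟶ (𝒜.baseChange ℓ).X,
          cℓ ≫ d = baseChangeHom (ρ𝒜.i a) ℓ ∧ d ≫ cℓ = baseChangeHom (ρℬ.i a) ℓ) ∧
        (∀ b, 𝔟 b → ∃ f : (𝒜.baseChange ℓ).X ⟶ (ℬ.baseChange ℓ).X,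
          cℓ ≫ baseChangeHom (ρℬ.i b) ℓ = f ≫ baseChangeHom (ρℬ.i ν) ℓ) ∧
        cℓ ≫ (polℬ.baseChange ℓ).lam ≫ DualPair.dualIsogenyOver cℓ (D𝒜.baseChange ℓ) (Dℬ.baseChange ℓ) =
          (pol𝒜.baseChange ℓ).lam ≫ (D𝒜.baseChange ℓ).hat.mulN N ∧
        (∀ a, baseChangeHom (ρ𝒜.i a) ℓ ≫ cℓ = cℓ ≫ baseChangeHom (ρℬ.i a) ℓ) ∧
        (∀ a : Fin g ⊕ Fin g → ZMod n,
          (AlgPoints.map cℓ (𝒜.restrictPt ℓ (lvl𝒜.section_ a)) : (ℬ.baseChange ℓ).toAffine.toAbelianVariety.Points Ω) =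
            ℬ.restrictPt ℓ (lvlℬ.section_ a)) := by
  haveI := isMonHom_baseChangeHom c ℓ
  refine ⟨baseChangeHom c ℓ, isMonHom_baseChangeHom c ℓ, fun a ha => ?_, fun b hb => ?_,
    DualPair.baseChangeHom_similitude_base ℓ c D𝒜 Dℬ pol𝒜.lam polℬ.lam N t3, fun a => ?_, fun a => ?_⟩
  · obtain ⟨d, hcd, hdc⟩ := t1 a ha
    refine ⟨baseChangeHom d ℓ, ?_, ?_⟩
    · change (Over.pullback ℓ).map c ≫ (Over.pullback ℓ).map d = (Over.pullback ℓ).map (ρ𝒜.i a)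
      rw [← Functor.map_comp, hcd]
    · change (Over.pullback ℓ).map d ≫ (Over.pullback ℓ).map c = (Over.pullback ℓ).map (ρℬ.i a)
      rw [← Functor.map_comp, hdc]
  · obtain ⟨f, hf⟩ := t2 b hb
    refine ⟨baseChangeHom f ℓ, ?_⟩
    change (Over.pullback ℓ).map c ≫ (Over.pullback ℓ).map (ρℬ.i b) = (Over.pullback ℓ).map f ≫ (Over.pullback ℓ).map (ρℬ.i ν)
    rw [← Functor.map_comp, ← Functor.map_comp, hf]
  · change (Over.pullback ℓ).map (ρ𝒜.i a) ≫ (Over.pullback ℓ).map c = (Over.pullback ℓ).map c ≫ (Over.pullback ℓ).map (ρℬ.i a)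
    rw [← Functor.map_comp, ← Functor.map_comp, t4 a]
  · refine map_restrictPt_section_eq_of_baseChange_σ_comp ℓ lvl𝒜 lvlℬ (baseChangeHom c ℓ) (fun i => ?_) a
    rw [LevelStructure.baseChange_σ, LevelStructure.baseChange_σ, sectionBaseChange_comp_baseChangeHom, ← t5 i]

end RowsAtPoint

end AbelianSchemeOver

end Literature.AlgebraicGeometry.AbelianSchemes

end
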